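import Mathlib
import Literature.Analysis.FluidPDE.Tao2016AveragedNS.BoundedEternalSolutions
import Summits.NavierStokesRegularity.NavierStokesRegularity.Theses.TaoLadderRungTwoBreak
import HarnessLib

/-!
# `TaoLadderRungTwoBreak.NoSurvivingEternalViscBddOneOfSplit` — the glue of the split of the
  Liouville crux by dissipation level (item stmt-NavierStokesRegularity-20453; one line over the
  tree theorem `TaoCascade.noSurvivingEternalViscBddOne_of`)

**Statement.** `NoSurvivingEternalBddOne → NoLoudLadderOne → NoSurvivingEternalViscBddOne`: the
bounded INVISCID Liouville (ρ0, `ν̂ = 0`) and the loud-ladder exclusion (ρ+, `ν̂ > 0`, every shell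
reaches the dissipation-critical level) give the bounded viscous Liouville at `a = 1`, for every
spread `R ≥ 1` — because the remaining case (some shell stays below the critical level: the seeded,
dissipation-dominated slice) is the tree THEOREM `TaoCascade.noSurvivingViscSeededBdd R 4096`,
consumed inside `TaoCascade.noSurvivingEternalViscBddOne_of`.

HONEST FRAMING: glue between the route's own statements about MODEL lattices (Tao 2016's cascade
class, cell vocabulary of `BoundedEternalSolutions`); nothing here is a statement about the
Navier–Stokes equations, and both hypotheses are open.
-/

noncomputable section

set_option linter.dupNamespace false

namespace Summit.NavierStokesRegularity.NavierStokesRegularity.Theorems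

open Summit.NavierStokesRegularity.NavierStokesRegularity.Theses.TaoLadderRungTwoBreak in
/-- **Item stmt-NavierStokesRegularity-20453** (`TaoLadderRungTwoBreak.NoSurvivingEternalViscBddOneOfSplit`):
the split children (ρ0) `NoSurvivingEternalBddOne` and (ρ+) `NoLoudLadderOne` imply the parent
`NoSurvivingEternalViscBddOne`, spread by spread, by `TaoCascade.noSurvivingEternalViscBddOne_of`.
[cite: Tao2016AveragedNS, §4 (the lattice class); cell vocabulary] -/
theorem taoLadderRungTwoBreak_noSurvivingEternalViscBddOneOfSplit_proof :
    Summit.NavierStokesRegularity.NavierStokesRegularity.Theses.TaoLadderRungTwoBreak.NoSurvivingEternalViscBddOneOfSplit := by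
  unfold Summit.NavierStokesRegularity.NavierStokesRegularity.Theses.TaoLadderRungTwoBreak.NoSurvivingEternalViscBddOneOfSplit
  intro h0 hL R hR
  exact Literature.Analysis.FluidPDE.TaoCascade.noSurvivingEternalViscBddOne_of (h0 R hR) (hL R hR)

end Summit.NavierStokesRegularity.NavierStokesRegularity.Theorems

end
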